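import Literature.AlgebraicGeometry.HodgeTheory.ThomGysinClosedImmersion
import HarnessLib

/-!
# Deligne, *Hodge III*, Cor. 8.2.8 split at Prop. 8.2.7: the Hodge-theoretic child as a named fact

Family `hodge`, layer `Literature/AlgebraicGeometry/HodgeTheory`. SPLIT RECORD (fact-decompose,
2026-08-16) of the named fact `Deligne1974_ker_restrictCompl_eq_iSup_range_complexGysin`
(`GysinKernel.lean`; P. Deligne, *Théorie de Hodge III*, Publ. Math. IHÉS 44 (1974), Cor. 8.2.8:
for `X` smooth projective, a finite family `g j : Y j ⟶ X` from smooth projective `Y j`,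
`Z = ⋃ j g_j(Y j)` and every `b`, `ker (Hᵇ(X(ℂ); ℂ) → Hᵇ((X ∖ Z)(ℂ); ℂ)) = Σ_j im (g j)_*`).

The printed proof (p. 40): "D'après (8.2.7), on a `Ker(i^*) = Ker(q^*)`. La suite exacte longue de
cohomologie du couple `(Y, X)` fournit donc une suite exacte (8.2.8.2) `H˙_c(U) → H˙(Y) →^{q^*} H˙(X̃)`,
et (8.2.8.1) est la suite transposée de (8.2.8.2) par dualité de Poincaré." The tree PROVES the
transposition and the inclusion `⊇` unconditionally (`GysinKernelProofs`,
`AlgebraicTopology/SingularHomology/GysinTransposition`, `ThomGysinClosedImmersion`: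
`Deligne1974_ker_restrictCompl_eq_iSup_range_complexGysin_of_pullback`), leaving exactly ONE
input, there a hypothesis `H` in the tree's vocabulary: **Prop. 8.2.7** ("Soient des morphismes de
schémas `X̃ →π X →f Y`. On suppose que `Y` est lisse, que `X` est propre, que `X̃` est propre et lisse
et que `π` est surjectif. Alors, les noyaux de `f^*` et de `(fπ)^*` dans `Hⁿ(Y, ℚ)` sont égaux"),
specialised to `Y := X` smooth projective, `X := Z` (the closed union of the images), `X̃ := ⊔ Y j`,
`π` surjective onto `Z` by definition, read with complex coefficients and in ČECH form — a class of
`Hᵠ(X(ℂ); ℂ)` killed by every `(g j)(ℂ)^*` vanishes on an open neighbourhood of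
`Z(ℂ) = {P | pt P ∈ Z}` (for the compact, locally contractible `Z(ℂ)` this is `x'|_{Z(ℂ)} = 0`, by
the tautness proved in `ThomGysinClosedImmersion`). Its content is Deligne's mixed Hodge theory
(weights, Hodge III 8.2.5: `W_{n-1} Hⁿ(Z) = Ker(Hⁿ(Z) → Hⁿ(Z̃))`; purity of `Hⁿ(X)`; strictness,
Hodge II Thm. 2.3.5), in neither Mathlib nor the tree. This file vendors that input as the named
fact `Deligne1974_ker_pullback_eq_ker_pullback_resolution` and records the assembly
`Deligne1974_ker_restrictCompl_eq_iSup_range_complexGysin_holds_of`.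

For ONE closed immersion of a smooth projective variety the child holds unconditionally
(`exists_isOpen_map_subsetIncl_eq_zero_of_isClosedImmersion`, tautness), which is how the
Thom–Gysin sequence is proved in the tree; the general case fails for non-algebraic
configurations, so no Hodge-free proof exists (module docstring of `ThomGysinClosedImmersion`).

## References

* [DeligneHodgeIII1974] P. Deligne, Théorie de Hodge III, Publ. Math. IHÉS 44 (1974), Prop. 8.2.5,
  Prop. 8.2.7, Cor. 8.2.8, Rem. 8.2.9 (p. 40).
* [DeligneHodgeII1971] P. Deligne, Théorie de Hodge II, Publ. Math. IHÉS 40 (1971), Thm. 2.3.5.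
* [VoisinChowRings2014] C. Voisin, Chow Rings, Decomposition of the Diagonal, and the Topology of
  Families (2014), Thm. 2.36, Thm. 2.39 and its proof.
-/

noncomputable section

open CategoryTheory AlgebraicGeometry
open Literature.AlgebraicTopology.SingularHomology

namespace Literature.AlgebraicGeometry.HodgeTheory

/-- **Deligne, *Hodge III*, Prop. 8.2.7** (the Hodge-theoretic input of Cor. 8.2.8), for a smooth
projective `X` over `ℂ` and a finite family of morphisms `g j : Y j ⟶ X` from smooth projective
`Y j` (Deligne's `X̃ = ⊔ Y j →π Z := ⋃ g_j(Y j) ↪ X`, `π` surjective by definition of `Z`):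
"les noyaux de `f^*` et de `(fπ)^*` dans `Hⁿ(Y, ℚ)` sont égaux", i.e. a class `x' ∈ Hᵠ(X(ℂ); ℂ)`
with `(g j)(ℂ)^* x' = 0` for all `j` already dies on `Z`; rendered in Čech form on the tree's
carriers (`complexBetti X q = Hᵠ(X(ℂ); ℂ)`): there is an open `V ⊇ {P | pt P ∈ ⋃ j, g_j(Y j)}` in
`X(ℂ)` with `x'|_V = 0` (`singularCohomology.map ℂ ℂ (subsetIncl V)`). Complex coefficients
(`= ℚ`-statement `⊗ ℂ`); the Čech form is equivalent to vanishing in `Hᵠ(Z(ℂ); ℂ)` by tautness of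
the compact ENR `Z(ℂ)`. Printed proof: mixed Hodge structures (Hodge III 8.2.2), the weight
computation 8.2.5 `W_{n-1}Hⁿ(Z) = Ker(Hⁿ(Z) → Hⁿ(X̃))`, purity of `Hⁿ(X)` and strictness
(Hodge II 2.3.5). This is verbatim the hypothesis `H` of
`Deligne1974_ker_restrictCompl_eq_iSup_range_complexGysin_of_pullback`.
[cite: DeligneHodgeIII1974, Prop. 8.2.7 (with Prop. 8.2.5), p. 40] -/
def Deligne1974_ker_pullback_eq_ker_pullback_resolution : Prop :=
  ∀ ⦃n : ℕ⦄ ⦃X : Motives.SchemeOver ℂ⦄ (_ : Motives.IsSmoothProjective n X)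
    ⦃ι : Type⦄ [Finite ι] ⦃m : ι → ℕ⦄ ⦃Y : ι → Motives.SchemeOver ℂ⦄
    (_ : ∀ j, Motives.IsSmoothProjective (m j) (Y j)) (g : ∀ j, Y j ⟶ X) (q : ℕ)
    (x' : complexBetti X q), (∀ j, complexBetti.map (g j) q x' = 0) →
    ∃ V : Set (Motives.ComplexPoints X), IsOpen V ∧
      {P | P.pt ∈ ⋃ j, Set.range (g j).left.base} ⊆ V ∧
      singularCohomology.map ℂ ℂ (subsetIncl V) q x' = 0

/-- **Assembly of the split: Cor. 8.2.8 from Prop. 8.2.7.** The named fact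
`Deligne1974_ker_restrictCompl_eq_iSup_range_complexGysin` follows from its single open child
`Deligne1974_ker_pullback_eq_ker_pullback_resolution`; the rest of the printed proof (Poincaré
duality transposition, the inclusion `⊇`) is the tree's
`Deligne1974_ker_restrictCompl_eq_iSup_range_complexGysin_of_pullback`.
[cite: DeligneHodgeIII1974, Cor. 8.2.8 (proof, p. 40)] -/
theorem Deligne1974_ker_restrictCompl_eq_iSup_range_complexGysin_holds_of
    (h : Deligne1974_ker_pullback_eq_ker_pullback_resolution) :
    Deligne1974_ker_restrictCompl_eq_iSup_range_complexGysin :=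
  Deligne1974_ker_restrictCompl_eq_iSup_range_complexGysin_of_pullback h

/-- Sanity (the child is not vacuous and is implied by nothing weaker in general, but its
one-morphism closed-immersion case HOLDS): for a closed immersion `i : H ⟶ X` of a smooth
projective `H`, the statement of the child for the one-member family `g = i` is the tree's
`exists_isOpen_map_subsetIncl_eq_zero_of_isClosedImmersion` (tautness of the compact submanifold
`H(ℂ)`). [cite: DeligneHodgeIII1974, Prop. 8.2.7] -/
theorem Deligne1974_ker_pullback_eq_ker_pullback_resolution.of_isClosedImmersion
    {n : ℕ} {X : Motives.SchemeOver ℂ} (hX : Motives.IsSmoothProjective n X)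
    {m : ℕ} {H : Motives.SchemeOver ℂ} (hH : Motives.IsSmoothProjective m H)
    (i : H ⟶ X) [IsClosedImmersion i.left] {q : ℕ}
    (x' : complexBetti X q) (hx' : complexBetti.map i q x' = 0) :
    ∃ V : Set (Motives.ComplexPoints X), IsOpen V ∧
      {P | P.pt ∈ Set.range i.left.base} ⊆ V ∧ singularCohomology.map ℂ ℂ (subsetIncl V) q x' = 0 :=
  exists_isOpen_map_subsetIncl_eq_zero_of_isClosedImmersion hX hH i x' hx'

end Literature.AlgebraicGeometry.HodgeTheory

end
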